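import Summits.ABC.IUTFork.Thm311RealIsmDHMoverDeep
import Summits.ABC.IUTFork.Thm311RealIsmDHMoverBoundary
import Literature.NumberTheory.NumberFields.CongruenceSubgroupTorsionFree
import Mathlib.NumberTheory.NumberField.Cyclotomic.Ideal
import HarnessLib

/-!
# [IUTchIII] Cor. 3.12, TEAM R: CYCLOTOMIC INSTANCES of the boundary / deep ball-mover theorems —
# `ℚ(ζ_p)` (fixed iff `p − 1 ∣ j − 2`), `ℚ(ζ_{pm})` with `ord_m(p) ≥ 2` and `ℚ(ζ_{p²})` (every ball moved)

PROOF-ONLY file (0 definitions, 0 named facts) of the abc-iut cell (block C / W6 prover seat abc-iut-w6-d060,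
gen 2; TEAM R «ismDH mover» record support); TAKES NO SIDE on [IUTchIII] Cor. 3.12.  NON-VACUITY of every exotic
row of the odd-`p` classification (`Thm311RealIsmDHMoverOddClassification`): the hypotheses «`e(v|p) = p − 1`,
`ζ_p ∈ F_v`, `f(v|p) = 1` / `≥ 2`» and «`e(v|p) ≥ p`» are met by explicit cyclotomic number fields, whose
ramification and inertia Mathlib computes (`IsCyclotomicExtension.Rat.ramificationIdx_eq` / `inertiaDeg_eq`:
for `n = p^{k+1}·m`, `p ∤ m`: `e = p^k(p − 1)`, `f = ord_m(p)`).

* §1 `F = ℚ(ζ_p)` (`IsCyclotomicExtension {p} ℚ F`), `p` odd, `v | p`: `e = p − 1`, `f = 1`, `ζ_p ∈ F_v`, so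
  (row W2) the ball `𝔪_v^j` is (Ind2)-fixed iff `(p − 1) ∣ (j − 2)`
  (`forall_ismDH_image_closedBall_eq_iff_dvd_two_cyclotomic_prime`); for `p ≥ 5` the unit ball `𝒪_v` is MOVED
  (`exists_mem_ismDH_image_unitBall_ne_cyclotomic_prime`; abc-iut-w5-d044's example «places over 5 of `F ∋ ζ_5`»).
* §2 `F = ℚ(ζ_{p·m})` (`IsCyclotomicExtension {p * m} ℚ F`), `p` odd, `p ∤ m`, `ord_m(p) ≥ 2`, `v | p`: `e = p − 1`,
  `f = ord_m(p) ≥ 2`, `ζ_p ∈ F_v`, so (row W3) EVERY ball `t·𝒪_v` is moved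
  (`exists_mem_ismDH_image_closedBall_ne_cyclotomic_prime_mul`); e.g. `ℚ(ζ_{15})` over `5`
  (`exists_mem_ismDH_image_closedBall_ne_cyclotomic_fifteen`: `e = 4`, `f = ord_3(5) = 2`).
* §3 `F = ℚ(ζ_{p²})` (`IsCyclotomicExtension {p ^ 2} ℚ F`), `p` odd, `v | p`: `e = p(p − 1) ≥ p`, so (deep row)
  EVERY ball is moved (`exists_mem_ismDH_image_closedBall_ne_cyclotomic_prime_sq`).
In each case such a place `v` exists (`exists_place_over`).

HONEST FRAMING as in the companion files: statements about Dupuy–Hilado's typed (Ind2) on one-factor hull-sets of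
the completions of these number fields; nothing about [IUTchIII] Cor. 3.12. [cite: DupuyHilado2025, §4.9]
[cite: WeilBNT1967, Ch. II §2, Th. 1–2] [cite: NeukirchANT1999, Ch. I (10.3), Ch. II Prop. (5.5)–(5.7), (7.13)]
[cite: Washington1997, Lemma 1.4, Prop. 2.3] [claim: Mochizuki2012, status: disputed] for every [IUTchIII] locution.
-/

noncomputable section

open Metric Set NumberField IsDedekindDomain
open scoped Pointwise

namespace Summit.ABC.IUTFork.Thm311.Real

open Cor312Vol Literature.IUT.LogThetaLattice Literature.IUT.LogVolume Literature.NumberTheory.NumberFields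
open Literature.NumberTheory.GaloisRepresentations.Ultrametric

namespace CyclotomicBoundary

variable (F : Type) [Field F] [NumberField F] {p : ℕ} [hp : Fact p.Prime]

/-- A number field has a finite place over `p`. [cite: NeukirchANT1999, Ch. I §8] -/
theorem exists_place_over : ∃ v : HeightOneSpectrum (𝓞 F), ((p : ℕ) : 𝓞 F) ∈ v.asIdeal :=
  Literature.NumberTheory.NumberFields.RingOfIntegers.exists_heightOneSpectrum_natCast_mem F hp.out

variable {F}
variable {logv : PadicLogs F} (hlog : LogvAnalyticAt p logv)
variable (v : HeightOneSpectrum (𝓞 F)) (hv : ((p : ℕ) : 𝓞 F) ∈ v.asIdeal)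

/-! ## 1. `ℚ(ζ_p)`: `e = p − 1`, `f = 1`, `ζ_p ∈ F` — row (W2) -/

section Prime

variable [hF : IsCyclotomicExtension {p} ℚ F]
include hv

/-- `e(v|p) = p − 1` at the place over `p` of `ℚ(ζ_p)`. [cite: Washington1997, Lemma 1.4] -/
theorem ramificationIdx_eq_of_cyclotomic_prime : v.asIdeal.ramificationIdx ℤ = p - 1 := by
  haveI := liesOver_span_of_natCast_mem F p v hv
  exact IsCyclotomicExtension.Rat.ramificationIdx_eq_of_prime p F v.asIdeal

/-- `f(v|p) = 1` at the place over `p` of `ℚ(ζ_p)`. [cite: Washington1997, Lemma 1.4] -/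
theorem inertiaDeg_eq_of_cyclotomic_prime : v.asIdeal.inertiaDeg ℤ = 1 := by
  haveI := liesOver_span_of_natCast_mem F p v hv
  exact IsCyclotomicExtension.Rat.inertiaDeg_eq_of_prime p F v.asIdeal

/-- `ζ_p` is a non-trivial `p`-th root of unity of the completion `F_v`. [cite: Washington1997, Lemma 1.4] -/
theorem exists_pow_eq_one_ne_one_of_cyclotomic_prime :
    ∃ ζ : RescaledCompletion F p v hv, ζ ^ p = 1 ∧ ζ ≠ 1 :=
  have hζ := IsCyclotomicExtension.zeta_spec p ℚ F
  exists_pow_eq_one_ne_one_rescaledCompletion hζ.pow_eq_one (hζ.ne_one hp.out.one_lt)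

include hlog

/-- **`ℚ(ζ_p)`, `p` odd: the ball `𝔪_v^j` at the place over `p` is fixed by EVERY (Ind2)-element iff
`(p − 1) ∣ (j − 2)`** (row W2 of the classification: `log_p(𝒪_v^×) = 𝔪_v²`). [cite: DupuyHilado2025, §4.9]
[cite: WeilBNT1967, Ch. II §2, Th. 2] [cite: Washington1997, §5.1] -/
theorem forall_ismDH_image_closedBall_eq_iff_dvd_two_cyclotomic_prime (hp2 : p ≠ 2)
    {ϖ : (RescaledCompletion F p v hv)ˣ} (hϖ : IsUniformizer ϖ) (j : ℤ) :
    (∀ g ∈ ismDH logv (.inr v),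
        (fun a => toR p v hv (g (ofR p v hv a))) ''
            closedBall (0 : RescaledCompletion F p v hv) ‖(ϖ : RescaledCompletion F p v hv) ^ j‖ =
          closedBall 0 ‖(ϖ : RescaledCompletion F p v hv) ^ j‖) ↔
      ((p - 1 : ℕ) : ℤ) ∣ (j - 2) := by
  obtain ⟨ζ, hζ, hζ1⟩ := exists_pow_eq_one_ne_one_of_cyclotomic_prime v hv
  rw [forall_ismDH_image_closedBall_eq_iff_dvd_two_of_boundary hlog hp2
    (ramificationIdx_eq_of_cyclotomic_prime v hv) (inertiaDeg_eq_of_cyclotomic_prime v hv) hϖ hζ hζ1 j,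
    ramificationIdx_eq_of_cyclotomic_prime v hv]

/-- **`ℚ(ζ_p)`, `p ≥ 5`: the UNIT BALL `𝒪_v` at the place over `p` is MOVED by some (Ind2)-element**
(`p − 1 ≥ 4` does not divide `−2`) — e.g. the place `(ζ_5 − 1)` of `ℚ(ζ_5)`. [cite: DupuyHilado2025, §4.9]
[cite: Washington1997, §5.1] -/
theorem exists_mem_ismDH_image_unitBall_ne_cyclotomic_prime (h5 : 5 ≤ p) :
    ∃ g ∈ ismDH logv (.inr v),
      (fun a => toR p v hv (g (ofR p v hv a))) '' closedBall (0 : RescaledCompletion F p v hv) 1 ≠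
        closedBall 0 1 := by
  obtain ⟨ζ, hζ, hζ1⟩ := exists_pow_eq_one_ne_one_of_cyclotomic_prime v hv
  exact exists_mem_ismDH_image_unitBall_ne_of_boundary hlog h5 (ramificationIdx_eq_of_cyclotomic_prime v hv)
    (inertiaDeg_eq_of_cyclotomic_prime v hv) hζ hζ1

end Prime

/-! ## 2. `ℚ(ζ_{pm})`, `p ∤ m`, `ord_m(p) ≥ 2`: `e = p − 1`, `f ≥ 2`, `ζ_p ∈ F` — row (W3) -/

section PrimeMul

variable {m : ℕ} [hF : IsCyclotomicExtension {p * m} ℚ F]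
include hv

/-- `e(v|p) = p − 1` at every place over `p` of `ℚ(ζ_{pm})`, `p ∤ m`. [cite: Washington1997, Prop. 2.3] -/
theorem ramificationIdx_eq_of_cyclotomic_prime_mul (hm : ¬ p ∣ m) : v.asIdeal.ramificationIdx ℤ = p - 1 := by
  haveI := liesOver_span_of_natCast_mem F p v hv
  have h := IsCyclotomicExtension.Rat.ramificationIdx_eq (p * m) F v.asIdeal (k := 0) (m := m)
    (by rw [zero_add, pow_one]) hm
  rwa [pow_zero, one_mul] at h

/-- `f(v|p) = ord_m(p)` at every place over `p` of `ℚ(ζ_{pm})`, `p ∤ m`. [cite: Washington1997, Prop. 2.3] -/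
theorem inertiaDeg_eq_of_cyclotomic_prime_mul (hm : ¬ p ∣ m) :
    v.asIdeal.inertiaDeg ℤ = orderOf (p : ZMod m) := by
  haveI := liesOver_span_of_natCast_mem F p v hv
  exact IsCyclotomicExtension.Rat.inertiaDeg_eq (p * m) F v.asIdeal (k := 0) (m := m)
    (by rw [zero_add, pow_one]) hm

/-- `ζ_{pm}^m` is a non-trivial `p`-th root of unity of `F_v`. [cite: Washington1997, Lemma 1.4] -/
theorem exists_pow_eq_one_ne_one_of_cyclotomic_prime_mul (hm0 : 0 < m) :
    ∃ ζ : RescaledCompletion F p v hv, ζ ^ p = 1 ∧ ζ ≠ 1 := by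
  haveI : NeZero (p * m) := ⟨(Nat.mul_pos hp.out.pos hm0).ne'⟩
  have hζ := (IsCyclotomicExtension.zeta_spec (p * m) ℚ F).pow (Nat.mul_pos hp.out.pos hm0) (mul_comm p m)
  exact exists_pow_eq_one_ne_one_rescaledCompletion hζ.pow_eq_one (hζ.ne_one hp.out.one_lt)

include hlog

/-- **`ℚ(ζ_{pm})`, `p` odd, `p ∤ m`, `ord_m(p) ≥ 2`: at every place over `p`, EVERY ball `t·𝒪_v` (`t ≠ 0`) is
moved by some (Ind2)-element** (row W3: `e = p − 1`, `ζ_p ∈ F_v`, `f ≥ 2` — `log_p(𝒪_v^×)` is no `𝒪_v`-module).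
[cite: DupuyHilado2025, §4.9] [cite: WeilBNT1967, Ch. II §2, Th. 1–2] [cite: Washington1997, §5.1, Prop. 2.3] -/
theorem exists_mem_ismDH_image_closedBall_ne_cyclotomic_prime_mul (hp2 : p ≠ 2) (hm : ¬ p ∣ m)
    (hord : 2 ≤ orderOf (p : ZMod m)) {t : RescaledCompletion F p v hv} (ht : t ≠ 0) :
    ∃ g ∈ ismDH logv (.inr v),
      (fun a => toR p v hv (g (ofR p v hv a))) '' closedBall (0 : RescaledCompletion F p v hv) ‖t‖ ≠
        closedBall 0 ‖t‖ := by
  have hm0 : 0 < m := by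
    rcases Nat.eq_zero_or_pos m with h | h
    · exact absurd (h ▸ dvd_zero p) hm
    · exact h
  obtain ⟨ζ, hζ, hζ1⟩ := exists_pow_eq_one_ne_one_of_cyclotomic_prime_mul v hv hm0
  refine exists_mem_ismDH_image_closedBall_ne_of_boundary_of_two_le_inertiaDeg hlog hp2
    (ramificationIdx_eq_of_cyclotomic_prime_mul v hv hm) ?_ hζ hζ1 ht
  rw [inertiaDeg_eq_of_cyclotomic_prime_mul v hv hm]
  exact hord

end PrimeMul

/-- **`ℚ(ζ_{15})` over `5`: EVERY ball is moved** (`15 = 5·3`, `5 ∤ 3`, `ord_3(5) = 2`: `e = 4`, `f = 2`, `ζ_5 ∈ F`).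
[cite: DupuyHilado2025, §4.9] [cite: Washington1997, Prop. 2.3] -/
theorem exists_mem_ismDH_image_closedBall_ne_cyclotomic_fifteen [Fact (Nat.Prime 5)]
    [IsCyclotomicExtension {5 * 3} ℚ F] {logv : PadicLogs F} (hlog : LogvAnalyticAt 5 logv)
    (v : HeightOneSpectrum (𝓞 F)) (hv : ((5 : ℕ) : 𝓞 F) ∈ v.asIdeal) {t : RescaledCompletion F 5 v hv}
    (ht : t ≠ 0) :
    ∃ g ∈ ismDH logv (.inr v),
      (fun a => toR 5 v hv (g (ofR 5 v hv a))) '' closedBall (0 : RescaledCompletion F 5 v hv) ‖t‖ ≠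
        closedBall 0 ‖t‖ := by
  refine exists_mem_ismDH_image_closedBall_ne_cyclotomic_prime_mul hlog v hv (m := 3) (by norm_num)
    (by norm_num) ?_ ht
  have h : orderOf ((5 : ℕ) : ZMod 3) = 2 := orderOf_eq_prime (by decide) (by decide)
  rw [h]

/-! ## 3. `ℚ(ζ_{p²})`: `e = p(p − 1) ≥ p` — the deep row -/

section PrimeSq

variable [hF : IsCyclotomicExtension {p ^ 2} ℚ F]
include hv

/-- `e(v|p) = p(p − 1)` at the place over `p` of `ℚ(ζ_{p²})`. [cite: Washington1997, Lemma 1.4] -/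
theorem ramificationIdx_eq_of_cyclotomic_prime_sq : v.asIdeal.ramificationIdx ℤ = p * (p - 1) := by
  haveI := liesOver_span_of_natCast_mem F p v hv
  haveI : IsCyclotomicExtension {p ^ (1 + 1)} ℚ F := hF
  rw [IsCyclotomicExtension.Rat.ramificationIdx_eq_of_prime_pow p 1 F v.asIdeal, pow_one]

include hlog

/-- **`ℚ(ζ_{p²})`, `p` odd: at the place over `p`, EVERY ball `t·𝒪_v` (`t ≠ 0`) is moved by some
(Ind2)-element** (deep row: `e = p(p − 1) ≥ p`). [cite: DupuyHilado2025, §4.9] [cite: WeilBNT1967, Ch. II §2, Th. 1–2]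
[cite: NeukirchANT1999, Ch. II Prop. (5.5)–(5.7)] -/
theorem exists_mem_ismDH_image_closedBall_ne_cyclotomic_prime_sq (hp2 : p ≠ 2)
    {t : RescaledCompletion F p v hv} (ht : t ≠ 0) :
    ∃ g ∈ ismDH logv (.inr v),
      (fun a => toR p v hv (g (ofR p v hv a))) '' closedBall (0 : RescaledCompletion F p v hv) ‖t‖ ≠
        closedBall 0 ‖t‖ := by
  have hp3 : 3 ≤ p := by have := hp.out.two_le; omega
  refine exists_mem_ismDH_image_closedBall_ne_of_prime_le_ramificationIdx hlog hp3 ?_ ht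
  rw [ramificationIdx_eq_of_cyclotomic_prime_sq v hv]
  calc p = p * 1 := (mul_one p).symm
    _ ≤ p * (p - 1) := Nat.mul_le_mul_left p (by omega)

end PrimeSq

end CyclotomicBoundary

end Summit.ABC.IUTFork.Thm311.Real

end
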